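import Literature.NumberTheory.LFunctions.DworkRationalityMeromorphyProofs
import HarnessLib

/-!
# Coefficientwise continuity of `L ↦ exp(L)` and `det(1 - AT) = exp(-∑ Tr(Aˢ)Tˢ/s)` (Koblitz V.3)

Part of the bottom-up proof of Dwork's rationality theorem
(`Literature/NumberTheory/LFunctions/DworkRationality.lean`), towards the named fact
`Dwork.dworkFredholmMatrix` (`…/DworkRationalityFredholm.lean`; Koblitz, GTM 58, Ch. V §3, Lemma 4).
Koblitz proves `det(1 - AT) = exp(-∑ Tr(Aˢ)Tˢ/s)` for finite matrices and leaves "the extension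
to the case when `A` is an infinite matrix as an exercise (Exercise 8)" (p. 131); the extension
is a passage to the limit over finite truncations, coefficient by coefficient. This file supplies
the two elementary ingredients of that limit argument:

* `Literature.NumberTheory.LFunctions.Dwork.tendsto_coeff_exp_subst` — if power series `L_a`
  (all without constant term) converge coefficientwise in degrees `≤ m` to `L`, then
  `[Tᵐ] exp(L_a) → [Tᵐ] exp(L)`: by `coeff_exp_subst_eq_sum'` and `PowerSeries.coeff_pow`,
  `[Tᵐ] exp(L)` is a fixed finite sum of finite products of the coefficients `[Tʲ]L`, `j ≤ m`;
* `Literature.NumberTheory.LFunctions.Dwork.charpolyRev_eq_exp_subst_neg` — for a finite square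
  matrix `A` over a commutative `ℚ`-algebra, `det(1 - TA) = exp(-∑_{s≥1} Tr(Aˢ)Tˢ/s)`
  (Koblitz's Lemma 4 for finite matrices, p. 131), from the accepted
  `Literature.AlgebraicGeometry.Motives.FrobeniusTrace.exp_subst_traceLogSeries_mul_charpolyRev`.

## References

* N. Koblitz, *p-adic Numbers, p-adic Analysis, and Zeta-Functions*, 2nd ed., GTM 58 (1984),
  Ch. V §3, Lemma 4, p. 131, and §4 Ex. 8. [Koblitz1984]
-/

open PowerSeries Filter Finset

noncomputable section

namespace Literature.NumberTheory.LFunctions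

namespace Dwork

/-! ### Coefficientwise continuity of powers and of `exp ∘ subst` -/

section Continuity

variable {R : Type*} [CommRing R] [TopologicalSpace R] [IsTopologicalRing R]
variable {α : Type*} {l : Filter α} {L : α → R⟦X⟧} {M : R⟦X⟧} {m : ℕ}

/-- Coefficientwise convergence in degrees `≤ m` passes to powers: `[Tʲ] L_aᵈ → [Tʲ] Lᵈ` for
`j ≤ m` (`[Tʲ] Lᵈ` is a finite sum of products of coefficients of degree `≤ j`,
`PowerSeries.coeff_pow`). [folklore] -/
theorem tendsto_coeff_pow (h : ∀ j ≤ m, Tendsto (fun a => coeff j (L a)) l (nhds (coeff j M)))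
    (d : ℕ) {j : ℕ} (hj : j ≤ m) :
    Tendsto (fun a => coeff j (L a ^ d)) l (nhds (coeff j (M ^ d))) := by
  classical
  simp_rw [coeff_pow]
  refine tendsto_finsetSum _ fun c hc => tendsto_finsetProd _ fun i hi => h (c i) ?_
  rw [mem_finsuppAntidiag] at hc
  refine le_trans ?_ (hc.1.le.trans hj)
  by_cases hic : i ∈ c.support
  · exact Finset.single_le_sum (fun k _ => Nat.zero_le (c k)) (hc.2 hic)
  · rw [Finsupp.notMem_support_iff.mp hic]; exact Nat.zero_le _

variable [Algebra ℚ R]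

/-- **Coefficientwise continuity of `exp ∘ subst`**: if the `L_a` and `L` have no constant term and
`[Tʲ] L_a → [Tʲ] L` for all `j ≤ m`, then `[Tᵐ] exp(L_a) → [Tᵐ] exp(L)` (the coefficient of `Tᵐ`
in `exp(L) = ∑_d Lᵈ/d!` is a fixed polynomial in `[T¹]L, …, [Tᵐ]L`). This is the limit step in
Koblitz's extension of `det(1 - AT) = exp(-∑ Tr(Aˢ)Tˢ/s)` to infinite matrices (Ch. V §3 Lemma 4,
§4 Ex. 8). [cite: Koblitz1984, Ch. V §3 Lemma 4] -/
theorem tendsto_coeff_exp_subst (hL : ∀ a, constantCoeff (L a) = 0) (hM : constantCoeff M = 0)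
    (h : ∀ j ≤ m, Tendsto (fun a => coeff j (L a)) l (nhds (coeff j M))) :
    Tendsto (fun a => coeff m ((exp R).subst (L a))) l (nhds (coeff m ((exp R).subst M))) := by
  simp_rw [coeff_exp_subst_eq_sum' (hL _), coeff_exp_subst_eq_sum' hM]
  exact tendsto_finsetSum _ fun d _ => (tendsto_coeff_pow h d le_rfl).const_mul _

end Continuity

/-! ### `det(1 - TA) = exp(-∑ Tr(Aˢ)Tˢ/s)` for finite matrices -/

section Finite

variable {R : Type*} [CommRing R] [Algebra ℚ R] {ι : Type*} [Fintype ι] [DecidableEq ι]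

/-- The logarithmic series `∑_{s ≥ 1} Tr(Aˢ) Tˢ / s` of a finite square matrix (the series in
Koblitz's Lemma 4, Ch. V §3; same convention as `Literature.AlgebraicGeometry.Motives.FrobeniusTrace`). [cite: Koblitz1984, Ch. V §3 Lemma 4] -/
def matrixTraceLogSeries (A : Matrix ι ι R) : R⟦X⟧ :=
  PowerSeries.mk fun s => (s : ℚ)⁻¹ • (A ^ s).trace

/-- `∑ Tr(Aˢ)Tˢ/s` has no constant term (`(0 : ℚ)⁻¹ = 0`). [folklore] -/
theorem constantCoeff_matrixTraceLogSeries (A : Matrix ι ι R) :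
    constantCoeff (matrixTraceLogSeries A) = 0 := by
  rw [← coeff_zero_eq_constantCoeff_apply, matrixTraceLogSeries, coeff_mk, Nat.cast_zero, inv_zero,
    zero_smul]

/-- **Koblitz's Lemma 4 for finite matrices** (Ch. V §3, p. 131: "`det(1 - AT) =
exp_p(-∑_{s=1}^∞ Tr(Aˢ)Tˢ/s)`", proved there by triangularising `A`; here from the accepted
`FrobeniusTrace.exp_subst_traceLogSeries_mul_charpolyRev`, `exp(∑ Tr(Aˢ)Tˢ/s) · det(1 - TA) = 1`):
`Matrix.charpolyRev A = exp(-∑_{s ≥ 1} Tr(Aˢ)Tˢ/s)` as power series. [cite: Koblitz1984, Ch. V §3 Lemma 4] -/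
theorem charpolyRev_eq_exp_subst_neg (A : Matrix ι ι R) :
    (A.charpolyRev : R⟦X⟧) = (exp R).subst (-matrixTraceLogSeries A) := by
  have h := Literature.AlgebraicGeometry.Motives.FrobeniusTrace.exp_subst_traceLogSeries_mul_charpolyRev A
  rw [mul_comm] at h
  exact (exp_subst_neg_eq_of_mul (constantCoeff_matrixTraceLogSeries A) h).symm

end Finite

end Dwork

end Literature.NumberTheory.LFunctions
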